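import Literature.Computability.AlgebraicComplexity.BI17FundamentalInvariantTensors
import HarnessLib

/-!
# Popov's stability criterion, instance `SL_m × SL_m × SL_m` on `⊗³ℂ^m` (as quoted in
# Bürgisser–Ikenmeyer 2017, proof of Prop. 4.10) — typed STATEMENT (named fact)

Source as typed: P. Bürgisser, C. Ikenmeyer, *Fundamental invariants of orbit closures*, J. Algebra
**477** (2017) 390–434 = arXiv:1511.02927 [BurgisserIkenmeyer2017], proof of Prop. 4.10 (TeX
`main.tex` L1927–1937, held text `paper:arxiv-1511.02927` p0017:L73–81), VERBATIM: "Recall that the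
`GL_m^3`-action induces an action of `G = GL_m^3/K` on `⊗³ℂ^m`. … The group `G_s := SL_m^3/K` is a
homomorphic image of `SL_m^3` and hence semisimple. Clearly, `SL_m^3 w = G_s w`. According to
[Luna 1973], or [Kraft 1984], `G_s w` is closed for almost all `w` since `stab'(w) = stab(w)/K` is
finite for almost all `w`." — and, in the parallel proof of Prop. 2.10 (L646–651, p0007:L73–77):
"A general result due to Luna [1973], see also [Kraft 1984], implies that `SL_m w` is closed for
almost all `w` if `SL_m ∩ stab(w)` is finite for almost all `w`. (This general result only requires
that `SL_m` is a semisimple group.)" The general result is V. L. Popov's STABILITY CRITERION (Popov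
1970; Kraft 1984, II.4.3.D Folgerung, p. 142; via Luna's étale slice theorem, Luna 1973 §III.4): for a
connected semisimple group `G` acting linearly on a vector space `V`, if the stabilizer of a
Zariski-generic point is finite (print allows: reductive) then the orbit of a Zariski-generic point
is closed. Neither Popov 1970 nor Kraft 1984 is held (acq-12121, acq-12120); Luna 1973 is held
privately (paper:url-52d244a6929f, p0024–p0025, the ingredients); the typed locus is BI's quotation.

This file types ONE named fact (D-0014), the INSTANCE `G = SL_m × SL_m × SL_m` (connected
semisimple for `m ≥ 2`), `V = ⊗³ℂ^m = (Fin m → Fin m → Fin m → ℂ)` with the action `actTensor`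
(`(g₁ ⊗ g₂ ⊗ g₃)·w`), in the tree's vocabulary of `BI17FundamentalInvariantTensors.lean`:
"almost all `w`" = `IsZariskiGenericTensor` (off the zero set of a nonzero polynomial in the `m³`
coordinates — a principal Zariski-open subset of the irreducible affine space `⊗³ℂ^m`, so "generic"
on BOTH sides and no claim about any individual tensor), "`G_s w = SL_m^3 w` is closed" =
`IsPolystableTensor` (BI Def. of §4.2, L1821: closedness of the `SL_m^3`-orbit; the tree renders it
in the Euclidean topology, which a Zariski-closed orbit satisfies a fortiori — so the typed
conclusion is weaker than print, never stronger), and the hypothesis "the `G_s`-stabilizer of `w`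
is finite" = finiteness of the `SL_m^3`-stabilizer `{g ∈ SL_m^3 | g·w = w}` (the kernel
`SL_m^3 ∩ K = {(ζ₁I, ζ₂I, ζ₃I) | ζᵢ^m = 1, ζ₁ζ₂ζ₃ = 1}` of `SL_m^3 → G_s` is finite, so this is
equivalent to finiteness of the `G_s`-stabilizer, and to BI's "stab'(w) = stab(w)/K finite").
It is the ⊗³-twin of `Popov1970_genericClosedOrbit_symPower` (`PopovStabilityCriterion.lean`,
val-lit-t13 g5: the instance `SL_m` on `Sym^D ℂ^m` quoted in BI's proof of Prop. 2.10), typed by the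
cell's ruling as a separate instance rather than one general statement (a general "connected
semisimple `G ≤ GL(V)`" is not tree vocabulary).
-- TODO(general form): Popov's criterion for an arbitrary connected semisimple `G` and `G`-module
-- `V` (and with "reductive" in place of "finite" generic stabilizer).

Consumer (the edge, a separate theorem-only file `BI17Prop410OfPopov.lean`): BI Prop. 4.10
(`BI2017_prop_4_10`, "almost all `w ∈ ⊗³ℂ^m` are polystable") follows BY NAME from this fact, A. M.
Popov's 1987 generic-trivial-stabilizer theorem (`BI2017_popov_trivialStabilizer`, `m ≥ 4`) and the
generic finiteness of the stabilizer on `⊗³ℂ³` (in print via the Thrall–Chanler classification; not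
in the tree); then Cor. 5.12 via `BI2017_cor_5_12_of_thm_4_2_of_prop_4_10`. Typed for the cell
`val-lit` (LADDER-VALIANT V3, a known-results layer). Honest framing: typed ≠ proved; nothing here
bears on VP versus VNP.

## References

* [BurgisserIkenmeyer2017] P. Bürgisser, C. Ikenmeyer, J. Algebra 477 (2017) 390–434 =
  arXiv:1511.02927, proof of Prop. 4.10 (L1927–1937) and of Prop. 2.10 (L646–651) — the quotation typed.
* V. L. Popov, *Stability criteria for the action of a semisimple group on a factorial manifold*,
  Izv. Akad. Nauk SSSR Ser. Mat. 34 (1970) 523–531 = Math. USSR-Izv. 4 (1970) 527–535 (acq-12121).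
* H. Kraft, *Geometrische Methoden in der Invariantentheorie*, Aspekte der Mathematik D1, Vieweg
  1984, II.4.3.D Folgerung (p. 142) (acq-12120).
* D. Luna, *Slices étales*, Bull. Soc. Math. France Mém. 33 (1973) 81–105, §III.4.
-/

namespace Literature.Computability.AlgebraicComplexity

/-- **Popov's stability criterion for `SL_m × SL_m × SL_m` acting on `⊗³ℂ^m` (`m ≥ 2`), as quoted
in BI 2017, proof of Prop. 4.10** (L1934–1936: "According to [Luna 1973], or [Kraft 1984], `G_s w` is
closed for almost all `w` since `stab'(w) = stab(w)/K` is finite for almost all `w`"; the general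
result "only requires that [the group] is semisimple", L650): if the `SL_m^3`-stabilizer
`{(g₁,g₂,g₃) ∈ SL_m^3 | (g₁ ⊗ g₂ ⊗ g₃) w = w}` is finite for Zariski-almost all `w ∈ ⊗³ℂ^m`, then the
`SL_m^3`-orbit of Zariski-almost all `w ∈ ⊗³ℂ^m` is closed (`w` is polystable). An INSTANCE of the
printed criterion (Popov 1970; Kraft 1984 II.4.3.D), weaker than print ("finite" for "reductive",
Euclidean-closed orbit for Zariski-closed).
[cite: BurgisserIkenmeyer2017, Prop. 4.10 (proof, quoting Popov 1970 / Luna 1973 / Kraft 1984 II.4.3.D)] -/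
def Popov1970_genericClosedOrbit_tensor : Prop :=
  ∀ m : ℕ, 2 ≤ m →
    IsZariskiGenericTensor (fun w : Fin m → Fin m → Fin m → ℂ =>
      {g : Matrix.SpecialLinearGroup (Fin m) ℂ × Matrix.SpecialLinearGroup (Fin m) ℂ ×
          Matrix.SpecialLinearGroup (Fin m) ℂ |
        actTensor (g.1 : Matrix (Fin m) (Fin m) ℂ) (g.2.1 : Matrix (Fin m) (Fin m) ℂ)
          (g.2.2 : Matrix (Fin m) (Fin m) ℂ) w = w}.Finite) →
    IsZariskiGenericTensor (IsPolystableTensor : (Fin m → Fin m → Fin m → ℂ) → Prop)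

/-- Unfolding of `Popov1970_genericClosedOrbit_tensor`.
[cite: BurgisserIkenmeyer2017, Prop. 4.10 (proof)] -/
theorem Popov1970_genericClosedOrbit_tensor_iff :
    Popov1970_genericClosedOrbit_tensor ↔
      ∀ m : ℕ, 2 ≤ m →
        IsZariskiGenericTensor (fun w : Fin m → Fin m → Fin m → ℂ =>
          {g : Matrix.SpecialLinearGroup (Fin m) ℂ × Matrix.SpecialLinearGroup (Fin m) ℂ ×
              Matrix.SpecialLinearGroup (Fin m) ℂ |
            actTensor (g.1 : Matrix (Fin m) (Fin m) ℂ) (g.2.1 : Matrix (Fin m) (Fin m) ℂ)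
              (g.2.2 : Matrix (Fin m) (Fin m) ℂ) w = w}.Finite) →
        IsZariskiGenericTensor (IsPolystableTensor : (Fin m → Fin m → Fin m → ℂ) → Prop) :=
  Iff.rfl

end Literature.Computability.AlgebraicComplexity
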